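import Mathlib.Geometry.Manifold.Riemannian.Basic
import Mathlib.Geometry.Manifold.VectorBundle.Riemannian
import Mathlib.Analysis.InnerProductSpace.Laplacian
import Summits.Ventures.HodgeRepro2.HostAPI.Carriers.Geometry.Kaehler.AlternatingAux
import Summits.Ventures.HodgeRepro2.HostAPI.Carriers.Geometry.Kaehler.HodgeStar
import Summits.Ventures.HodgeRepro2.HostAPI.Carriers.Geometry.Kaehler.ManifoldForms
import Summits.Ventures.HodgeRepro2.HostAPI.Util.ForallBinderLint
open HostAPI.Carriers

noncomputable section

open scoped Manifold ContDiff Topology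
open Bundle Module

namespace HostAPI.Carriers.Geometry.Kaehler

variable {E : Type*} [NormedAddCommGroup E] [NormedSpace ℝ E] {n : ℕ} [Fact (finrank ℝ E = n)]
  {H : Type*} [TopologicalSpace H] {I : ModelWithCorners ℝ E H}
  {M : Type*} [TopologicalSpace M] [ChartedSpace H M]

instance instFactFinrankTangentSpace (x : M) : Fact (finrank ℝ (TangentSpace I x) = n) := ‹_›

section VolumeForm

variable [RiemannianBundle (fun x : M ↦ TangentSpace I x)]
  (o : (x : M) → Orientation ℝ (TangentSpace I x) (Fin n))

def riemannianVolumeForm : MForm I M ℝ n := fun x ↦ (o x).volumeFormL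

@[simp]
theorem riemannianVolumeForm_apply (x : M) : riemannianVolumeForm o x = (o x).volumeFormL :=
  rfl

end VolumeForm

variable [FiniteDimensional ℝ E]

instance instFiniteDimensionalTangentSpace (x : M) : FiniteDimensional ℝ (TangentSpace I x) :=
  inferInstanceAs (FiniteDimensional ℝ E)

variable [RiemannianBundle (fun x : M ↦ TangentSpace I x)] {k m : ℕ}

section Pointwise

variable (n) in

def MForm.inner (α β : MForm I M ℝ k) : M → ℝ := fun x ↦
  alternatingFormInner (TangentSpace I x) n k (α x) (β x)

variable (o : (x : M) → Orientation ℝ (TangentSpace I x) (Fin n))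

def MForm.hodgeStar (h : k + m = n) : MForm I M ℝ k →ₗ[ℝ] MForm I M ℝ m :=
  LinearMap.pi fun x ↦ (HostAPI.Carriers.Geometry.Kaehler.hodgeStar (o x) h).comp (LinearMap.proj x)

@[simp]
theorem MForm.hodgeStar_apply (h : k + m = n) (α : MForm I M ℝ k) (x : M) :
    MForm.hodgeStar o h α x = HostAPI.Carriers.Geometry.Kaehler.hodgeStar (o x) h (α x) :=
  rfl

def MForm.hodgeStar_hodgeStar : Prop :=
  ∀ (h : k + m = n) (h' : m + k = n) (α : MForm I M ℝ k),
    MForm.hodgeStar o h' (MForm.hodgeStar o h α) = ((-1 : ℝ) ^ (k * m)) • α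

def mcoderiv (h : (k + 1) + m = n) (α : MForm I M ℝ (k + 1)) : MForm I M ℝ k :=
  ((-1 : ℝ) ^ (n * k + 1)) •
    MForm.hodgeStar o (show (m + 1) + k = n by omega) (mextDeriv (MForm.hodgeStar o h α))

def hodgeLaplacian : (k m : ℕ) → k + m = n → MForm I M ℝ k → MForm I M ℝ k
  | 0, 0, _, _ => 0
  | 0, m + 1, _, α => mcoderiv o (m := m) (show (0 + 1) + m = n by omega) (mextDeriv α)
  | k + 1, 0, _, α => mextDeriv (mcoderiv o (m := 0) (show (k + 1) + 0 = n by omega) α)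
  | k + 1, m + 1, h, α => mextDeriv (mcoderiv o (m := m + 1) h α) +
      mcoderiv o (m := m) (show (k + 1 + 1) + m = n by omega) (mextDeriv α)

def IsHarmonicForm (h : k + m = n) (α : MForm I M ℝ k) : Prop :=
  IsSmoothForm α ∧ hodgeLaplacian o k m h α = 0

def harmonicForms (h : k + m = n) : Submodule ℝ (MForm I M ℝ k) :=
  Submodule.span ℝ {α | IsHarmonicForm o h α}

theorem subset_harmonicForms (h : k + m = n) :
    {α | IsHarmonicForm o h α} ⊆ (harmonicForms o h : Set (MForm I M ℝ k)) :=
  Submodule.subset_span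

theorem isHarmonicForm_zero (h : k + m = n) : IsHarmonicForm o h (0 : MForm I M ℝ k) := by
  refine ⟨isSmoothForm_zero, ?_⟩
  rcases k with - | k <;> rcases m with - | m <;>
    simp [hodgeLaplacian, mcoderiv, mextDeriv_zero]

section TopDegree

omit [RiemannianBundle fun x : M ↦ TangentSpace I x] in

theorem MForm.eq_zero_of_finrank_lt {j : ℕ} (α : MForm I M ℝ (n + j + 1)) : α = 0 := by
  funext x
  ext v
  have hV : finrank ℝ (TangentSpace I x) = n := Fact.out
  have hli : ¬ LinearIndependent ℝ v := by
    intro hli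
    have := hli.fintype_card_le_finrank
    simp only [Fintype.card_fin, hV] at this
    omega
  simpa using (α x).toAlternatingMap.map_linearDependent v hli

omit [RiemannianBundle fun x : M ↦ TangentSpace I x] in

theorem mextDeriv_eq_zero_of_top_degree (α : MForm I M ℝ n) : mextDeriv α = 0 :=
  MForm.eq_zero_of_finrank_lt (j := 0) _

theorem mextDeriv_riemannianVolumeForm : mextDeriv (riemannianVolumeForm o) = 0 :=
  mextDeriv_eq_zero_of_top_degree _

end TopDegree

end Pointwise

section SmoothnessPredicates

def isSmoothForm_hodgeStar (o : (x : M) → Orientation ℝ (TangentSpace I x) (Fin n)) : Prop :=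
  ∀ (ho : IsSmoothForm (riemannianVolumeForm o)) (h : k + m = n) {α : MForm I M ℝ k} (hα : IsSmoothForm α),
    IsSmoothForm (MForm.hodgeStar o h α)

def isSmoothForm_mcoderiv (o : (x : M) → Orientation ℝ (TangentSpace I x) (Fin n)) : Prop :=
  ∀ (ho : IsSmoothForm (riemannianVolumeForm o)) (h : (k + 1) + m = n) {α : MForm I M ℝ (k + 1)} (hα : IsSmoothForm α),
    IsSmoothForm (mcoderiv o h α)

def mcoderiv_mcoderiv (o : (x : M) → Orientation ℝ (TangentSpace I x) (Fin n)) : Prop :=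
  ∀ (ho : IsSmoothForm (riemannianVolumeForm o)) (h : (k + 1 + 1) + m = n) {α : MForm I M ℝ (k + 1 + 1)} (hα : IsSmoothForm α),
    mcoderiv o (show (k + 1) + (m + 1) = n by omega) (mcoderiv o h α) = 0

def mem_harmonicForms_iff (o : (x : M) → Orientation ℝ (TangentSpace I x) (Fin n)) : Prop :=
  ∀ (ho : IsSmoothForm (riemannianVolumeForm o)) (h : k + m = n) (α : MForm I M ℝ k),
    α ∈ harmonicForms o h ↔ IsHarmonicForm o h α

def isHarmonicForm_iff_mextDeriv_eq_zero_and_mcoderiv_eq_zero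
    (o : (x : M) → Orientation ℝ (TangentSpace I x) (Fin n)) : Prop :=
  ∀ [CompactSpace M] [I.Boundaryless] (ho : IsSmoothForm (riemannianVolumeForm o)) (h : (k + 1) + m = n) {α : MForm I M ℝ (k + 1)} (hα : IsSmoothForm α),
    IsHarmonicForm o h α ↔ mextDeriv α = 0 ∧ mcoderiv o h α = 0

end SmoothnessPredicates

section Flat

open Laplacian

variable {V : Type*} [NormedAddCommGroup V] [InnerProductSpace ℝ V] [FiniteDimensional ℝ V]
  [Fact (finrank ℝ V = n)] (oV : Orientation ℝ V (Fin n))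

def hodgeLaplacian_constOfIsEmpty_eq_neg_laplacian : Prop :=
  ∀ {f : V → ℝ} (hf : ContDiff ℝ ∞ f),
    hodgeLaplacian (I := 𝓘(ℝ, V)) (fun _ ↦ oV) 0 n (Nat.zero_add n)
        (fun x ↦ ContinuousAlternatingMap.constOfIsEmpty ℝ (TangentSpace 𝓘(ℝ, V) x) (Fin 0)
          (f x)) =
      fun x ↦ ContinuousAlternatingMap.constOfIsEmpty ℝ (TangentSpace 𝓘(ℝ, V) x) (Fin 0)
        (-(Δ f) x)

end Flat

end HostAPI.Carriers.Geometry.Kaehler
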